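import Literature.Computability.Cryptography.LWEPrimePowerProgData
import HarnessLib

/-!
# The Micciancio–Peikert machine, II: slices, scalars cut from the coins, and modular sample arithmetic on lists

Topic `Computability/Cryptography` (LWE), grouping namespace `LWE.MP12.Prog`, sequel of
`LWEPrimePowerProgData.lean`. Proved material (no named fact) towards
`Literature.Computability.Cryptography.blprs_gapSVP_sqrt_dim_to_lwe_classical` (**pqc.S21**),
hypothesis `h₂`: the list-level operations from which the oracle queries are assembled, each with its
polynomial-time realisation on codes (`CodeFP`):

* `sliceAt l off len`, `strSliceAt` (a segment of a list / of the coin string), `scalarAt r e i`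
  (the `i`-th scalar: `e` consecutive coins read in binary, least significant first — the list form
  of `chunkVal`, `scalarAt_eq_bitsToNat`);
* `aggItem Q d grp` (the coordinatewise sum mod `Q` of a group of samples — the list form of
  `sumSamples`), `addB` (`b ↦ b + x mod Q`), `shiftItem Q τ` (`(a, b) ↦ (a, b + ⟨a, τ⟩)` — the list
  form of `shiftSample`), `bumpCoord Q c x` (`a ↦ a + x·e_c` — the list form of `digitTransform`'s
  first component), and their `codeFP_*`.

## References

* D. Micciancio, C. Peikert, *Trapdoors for lattices: simpler, tighter, faster, smaller*, EUROCRYPT 2012,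
  LNCS 7237; full version IACR ePrint 2011/501, §3, Thm. 3.1 proof. [MicciancioPeikert2012]
* S. Arora, B. Barak, *Computational Complexity: A Modern Approach*, CUP 2009, §1.3. [AroraBarak2009]
-/

namespace Literature.Computability.Cryptography

namespace LWE

namespace MP12

namespace Prog

open _root_.Computability Polynomial Literature.Computability.Complexity Literature.Computability.Complexity.CodeFP

/-! ### Slices -/

/-- A segment of a list. [folklore] -/
def sliceAt {α : Type} (l : List α) (off len : ℕ) : List α := (l.drop off).take len

/-- **Segments of raw lists on codes** (offset and length in binary). [cite: AroraBarak2009, §1.3] -/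
theorem codeFP_sliceAt {α : Type} (eα : α → List Bool) :
    CodeFP (pairE (rawE eα) (pairE natE natE)) (rawE eα) (fun p => sliceAt p.1 p.2.1 p.2.2) := by
  have hl : CodeFP (pairE (rawE eα) (pairE natE natE)) (rawE eα) (fun p => p.1) := fst _ _
  have hL : CodeFP (pairE (rawE eα) (pairE natE natE)) unE (fun p => p.1.length) := (ulength eα).comp hl
  have hoff : CodeFP (pairE (rawE eα) (pairE natE natE)) unE (fun p => min p.2.1 p.1.length) :=
    unOfNatMin.comp (hL.pair (snd _ _).fst')
  have hlen : CodeFP (pairE (rawE eα) (pairE natE natE)) unE (fun p => min p.2.2 p.1.length) :=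
    unOfNatMin.comp (hL.pair (snd _ _).snd')
  refine ((rawTakeUn eα).comp (hlen.pair ((rawDropUn eα).comp (hoff.pair hl)))).congr fun p => ?_
  obtain ⟨l, off, len⟩ := p
  simp only [sliceAt]
  rw [show List.drop (min off l.length) l = List.drop off l from by
    rcases le_total off l.length with h | h
    · rw [Nat.min_eq_left h]
    · rw [Nat.min_eq_right h, List.drop_of_length_le h, List.drop_of_length_le le_rfl]]
  rcases le_total len l.length with h | h
  · rw [Nat.min_eq_left h]
  · rw [Nat.min_eq_right h, List.take_of_length_le (by simp), List.take_of_length_le (by simp; omega)]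

/-- A segment of a string. [folklore] -/
def strSliceAt (w : List Bool) (off len : ℕ) : List Bool := (w.drop off).take len

/-- **Segments of strings on codes.** [cite: AroraBarak2009, §1.3] -/
theorem codeFP_strSliceAt : CodeFP (pairE strE (pairE natE natE)) strE (fun p => strSliceAt p.1 p.2.1 p.2.2) := by
  have hl : CodeFP (pairE strE (pairE natE natE)) strE (fun p => p.1) := fst _ _
  have hL : CodeFP (pairE strE (pairE natE natE)) unE (fun p => p.1.length) := strLength.comp hl
  have hoff : CodeFP (pairE strE (pairE natE natE)) unE (fun p => min p.2.1 p.1.length) :=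
    unOfNatMin.comp (hL.pair (snd _ _).fst')
  have hlen : CodeFP (pairE strE (pairE natE natE)) unE (fun p => min p.2.2 p.1.length) :=
    unOfNatMin.comp (hL.pair (snd _ _).snd')
  refine (strTake.comp (hlen.pair (strDrop.comp (hoff.pair hl)))).congr fun p => ?_
  obtain ⟨l, off, len⟩ := p
  simp only [strSliceAt]
  rw [show List.drop (min off l.length) l = List.drop off l from by
    rcases le_total off l.length with h | h
    · rw [Nat.min_eq_left h]
    · rw [Nat.min_eq_right h, List.drop_of_length_le h, List.drop_of_length_le le_rfl]]
  rcases le_total len l.length with h | h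
  · rw [Nat.min_eq_left h]
  · rw [Nat.min_eq_right h, List.take_of_length_le (by simp), List.take_of_length_le (by simp; omega)]

/-- **The `i`-th scalar cut from the coins**: `e` consecutive coins read in binary, least significant
first. [cite: AroraBarak2009, Def. 7.1] -/
def scalarAt (r : List Bool) (e i : ℕ) : ℕ := bitsToNat (strSliceAt r (i * e) e)

/-- **Scalars on codes.** [cite: AroraBarak2009, §1.3] -/
theorem codeFP_scalarAt : CodeFP (pairE strE (pairE natE natE)) natE (fun p => scalarAt p.1 p.2.1 p.2.2) :=
  (strVal.comp (codeFP_strSliceAt.comp ((fst _ _).pair ((natMul.comp ((snd _ _).snd'.pair (snd _ _).fst')).pair (snd _ _).fst')))).congr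
    fun _ => rfl

/-! ### Modular sample arithmetic -/

/-- **The coordinatewise sum mod `Q` of a group of samples** (dimension `d`). [cite: MicciancioPeikert2012, Thm. 3.1 proof (p. 15, first step)] -/
def aggItem (Q d : ℕ) (grp : List LItem) : LItem :=
  ((List.range d).map fun cc => sumMod Q (grp.map fun x => x.1.getD cc 0), sumMod Q (grp.map Prod.snd))

/-- **Aggregation on codes** (context: `Q` binary, `d` unary). [cite: AroraBarak2009, §1.3] -/
theorem codeFP_aggItem : CodeFP (pairE (pairE natE unE) (rawE itemE)) itemE (fun p => aggItem p.1.1 p.1.2 p.2) := by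
  -- the `b`-part
  have hb : CodeFP (pairE (pairE natE unE) (rawE itemE)) natE (fun p => sumMod p.1.1 (p.2.map Prod.snd)) :=
    codeFP_sumMod.comp ((fst _ _).fst'.pair ((map₀ (snd (listE natE) natE)).comp (snd _ _)))
  -- the `a`-part: context `((Q, 1ᵈ), grp)`, item `cc`
  have hcol : CodeFP (pairE (pairE (pairE natE unE) (rawE itemE)) natE) natE
      (fun t => sumMod t.1.1.1 (t.1.2.map fun x => x.1.getD t.2 0)) := by
    have hget : CodeFP (pairE natE itemE) natE (fun q => q.2.1.getD q.1 0) :=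
      (rawGetD natE (d := 0) rfl).comp (((rawOfList natE).comp (snd _ _).fst').pair (fst _ _))
    exact codeFP_sumMod.comp ((fst _ _).fst'.fst'.pair ((map hget).comp ((snd _ _).pair (fst _ _).snd')))
  have ha : CodeFP (pairE (pairE natE unE) (rawE itemE)) (rawE natE)
      (fun p => (List.range p.1.2).map fun cc => sumMod p.1.1 (p.2.map fun x => x.1.getD cc 0)) :=
    ((map hcol).comp ((CodeFP.id _).pair ((rangeOf.comp ((fst _ _).snd'.pair (natOfUn.comp (fst _ _).snd'))).congr
      fun p => by show List.range (min p.1.2 p.1.2) = List.range p.1.2; rw [min_self]))).congr fun _ => rfl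
  exact (((listOfRaw natE).comp ha).pair hb).congr fun _ => rfl

/-- `b ↦ b + x mod Q`. [folklore] -/
def addB (Q : ℕ) (x : LItem) (v : ℕ) : LItem := (x.1, (x.2 + v) % max Q 1)

/-- `addB` on codes (context `Q`). [cite: AroraBarak2009, §1.3] -/
theorem codeFP_addB : CodeFP (pairE natE (pairE itemE natE)) itemE (fun p => addB p.1 p.2.1 p.2.2) :=
  ((snd _ _).fst'.fst'.pair (natMod.comp ((natAdd.comp ((snd _ _).fst'.snd'.pair (snd _ _).snd')).pair
    (natMax.comp ((fst _ _).pair (const _ 1)))))).congr fun _ => rfl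

/-- **Regev's shift on lists**: `(a, b) ↦ (a, b + ⟨a, τ⟩ mod Q)`. [cite: RegevLWE2009, §4 (proof of Lemma 4.1)] -/
def shiftItem (Q : ℕ) (τ : List ℕ) (x : LItem) : LItem := (x.1, (x.2 + dotMod Q x.1 τ) % max Q 1)

/-- `shiftItem` on codes (context `(Q, τ)`). [cite: AroraBarak2009, §1.3] -/
theorem codeFP_shiftItem : CodeFP (pairE (pairE natE (rawE natE)) itemE) itemE (fun p => shiftItem p.1.1 p.1.2 p.2) :=
  (codeFP_addB.comp ((fst _ _).fst'.pair ((snd _ _).pair (codeFP_dotMod.comp ((fst _ _).fst'.pair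
    (((rawOfList natE).comp (snd _ _).fst').pair (fst _ _).snd')))))).congr fun _ => rfl

/-- `a ↦ a + x·e_c` (mod `Q`) on the `a`-part. [cite: MicciancioPeikert2012, Thm. 3.1 proof, Eq. (3.1)] -/
def bumpCoord (Q c v : ℕ) (x : LItem) : LItem := (x.1.set c ((x.1.getD c 0 + v) % max Q 1), x.2)

/-- `bumpCoord` on codes (context `(Q, (c, v))`). [cite: AroraBarak2009, §1.3] -/
theorem codeFP_bumpCoord : CodeFP (pairE (pairE natE (pairE natE natE)) itemE) itemE (fun p => bumpCoord p.1.1 p.1.2.1 p.1.2.2 p.2) := by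
  have hQ : CodeFP (pairE (pairE natE (pairE natE natE)) itemE) natE (fun p => p.1.1) := (fst _ _).fst'
  have hc : CodeFP (pairE (pairE natE (pairE natE natE)) itemE) natE (fun p => p.1.2.1) := (fst _ _).snd'.fst'
  have hv : CodeFP (pairE (pairE natE (pairE natE natE)) itemE) natE (fun p => p.1.2.2) := (fst _ _).snd'.snd'
  have ha : CodeFP (pairE (pairE natE (pairE natE natE)) itemE) (rawE natE) (fun p => p.2.1) := (rawOfList natE).comp (snd _ _).fst'
  have hnew : CodeFP (pairE (pairE natE (pairE natE natE)) itemE) natE (fun p => (p.2.1.getD p.1.2.1 0 + p.1.2.2) % max p.1.1 1) :=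
    natMod.comp ((natAdd.comp (((rawGetD natE (d := 0) rfl).comp (ha.pair hc)).pair hv)).pair (natMax.comp (hQ.pair (const _ 1))))
  exact (((listOfRaw natE).comp ((setAt natE).comp (ha.pair (hc.pair hnew)))).pair (snd _ _).snd').congr fun _ => rfl

end Prog

end MP12

end LWE

end Literature.Computability.Cryptography
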